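import Mathlib
import Summits.Ventures.PercRepro2.Defs
import Summits.Ventures.PercRepro2.Harris
import Summits.Ventures.PercRepro2.Graph
import Summits.Ventures.PercRepro2.Events
import Summits.Ventures.PercRepro2.Induced
import Summits.Ventures.PercRepro2.BHKEvents
import Summits.Ventures.PercRepro2.R21PinInduction

/-!
# (R2-1) from the conditional-covariance bound (V5) (PercRepro2, p2)

The four-vertex inequality **(R2-1)** of the (PM⁺) line (the hypothesis `hR` of
`psi_bern_t_of_r21_psi0`) — with `𝟙 = {s ↮ y}`, `a = {u ∈ C_s}`, `h = {o ∈ C_s}`, `ℓ = {o ↔ y}`,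

  `P(𝟙a)·P(h) + P(𝟙h)·P(a) + P(𝟙ℓ)·P(a) ≤ P(𝟙ah) + P(𝟙ℓa) + P(𝟙)·P(ah)`

— has an EXACT decomposition with a single sign-free term.  Write `Q = 𝟙 = {s ↮ y}`, `S = {s ↔ y}`,
`m = h ∪ ℓ = {o ∈ C_s ∪ C_y}` (on `Q` the union `h ⊔ ℓ` is disjoint, on `S` both equal `h`).  Then

  `(R2-1) = P(Q)·[P(am) − P(a)P(m)] + [P(Q)·P(Qah) − P(Qa)·P(Qh)] + H₅`,
  `H₅ := P(S)·P(Qam) + P(Sa)·P(Sm) − P(S)·P(a)·P(m)`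

(`r21_slack_eq_v5_decomposition`, a ring identity after the four mass relations
`P(am) = P(ah) + P(Qaℓ)`, `P(m) = P(h) + P(Qℓ)`, `P(Qam) = P(Qah) + P(Qaℓ)`, `P(Sm) = P(Sh)`).
The first bracket is Harris (`a`, `m` increasing), the second is BHK06 Theorem 1.2 for the cluster
of `s` under the avoidance `s ↮ y` (`bhk_same_cluster_events`), and `H₅ ≥ 0` is the statement

  **(V5)**  `P(S)·P(a)·P(m) ≤ P(S)·P(Q a m) + P(S a)·P(S m)`,  i.e.  `Cov(a, m) ≥ P(S)·Cov(a, m | S)`,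
  i.e.  `Cov(a, m | Q) + P(S)·(P(a | S) − P(a | Q))·(P(m | S) − P(m | Q)) ≥ 0`

(P2-G20 record; census 0 violations).  Hence **(V5) ⟹ (R2-1)** unconditionally (`r21_of_v5`).

* `conn_s_y_of_conn_y_o_conn_s_o_v5`, `conn_s_o_of_conn_s_y_conn_y_o_v5` — the two graph facts;
* `inter_union_eq_v5`, `union_eq_v5`, `inter_union_inter_compl_eq_v5`, `union_inter_eq_v5` — the
  event identities, with the disjointness lemmas `disjoint_*_v5`;
* `r21_slack_eq_v5_decomposition` — the exact decomposition;
* `r21_of_v5` — **(V5) ⟹ (R2-1)**.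
-/

namespace Summit.Ventures.PercRepro2

section R21OfV5

variable {V : Type*} [Fintype V] [DecidableEq V] {E : Type*} [Fintype E] [DecidableEq E]
  {R : Type*} [CommRing R] [LinearOrder R] [IsStrictOrderedRing R]

omit [Fintype V] [DecidableEq V] [Fintype E] [DecidableEq E] in
/-- `o ↔ y` and `o ∈ C_s` give `s ↔ y`. -/
lemma conn_s_y_of_conn_y_o_conn_s_o_v5 {ends : E → Sym2 V} {ω : Config E} {s y o : V}
    (h₁ : ω ∈ connEvent ends y o) (h₂ : ω ∈ clusterInEvent ends s {W : Set V | o ∈ W}) :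
    ω ∈ connEvent ends s y := by
  have h₂' : Conn ends ω s o := h₂
  exact conn_trans h₂' (conn_symm h₁)

omit [Fintype V] [DecidableEq V] [Fintype E] [DecidableEq E] in
/-- `s ↔ y` and `o ↔ y` give `o ∈ C_s`. -/
lemma conn_s_o_of_conn_s_y_conn_y_o_v5 {ends : E → Sym2 V} {ω : Config E} {s y o : V}
    (h₁ : ω ∈ connEvent ends s y) (h₂ : ω ∈ connEvent ends y o) :
    ω ∈ clusterInEvent ends s {W : Set V | o ∈ W} := by
  show Conn ends ω s o
  exact conn_trans h₁ h₂

omit [Fintype V] [DecidableEq V] [Fintype E] [DecidableEq E] in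
/-- `a ∩ (h ∪ ℓ) = (a ∩ h) ∪ (a ∩ ℓ ∩ Q)`. -/
lemma inter_union_eq_v5 (ends : E → Sym2 V) (s y o u : V) :
    connEvent ends s u ∩ (clusterInEvent ends s {W : Set V | o ∈ W} ∪ connEvent ends y o) =
      (connEvent ends s u ∩ clusterInEvent ends s {W : Set V | o ∈ W}) ∪
        (connEvent ends s u ∩ connEvent ends y o ∩ (connEvent ends s y)ᶜ) := by
  ext ω
  constructor
  · rintro ⟨ha, hm⟩
    by_cases hh : ω ∈ clusterInEvent ends s {W : Set V | o ∈ W}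
    · exact Or.inl ⟨ha, hh⟩
    · rcases hm with hm | hm
      · exact absurd hm hh
      · refine Or.inr ⟨⟨ha, hm⟩, fun hS => hh ?_⟩
        exact conn_s_o_of_conn_s_y_conn_y_o_v5 hS hm
  · rintro (⟨ha, hh⟩ | ⟨⟨ha, hl⟩, _⟩)
    · exact ⟨ha, Or.inl hh⟩
    · exact ⟨ha, Or.inr hl⟩

omit [Fintype V] [DecidableEq V] [Fintype E] [DecidableEq E] in
/-- `a ∩ h` and `a ∩ ℓ ∩ Q` are disjoint (`ℓ ∩ Q ⊆ hᶜ`). -/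
lemma disjoint_inter_v5 (ends : E → Sym2 V) (s y o u : V) :
    Disjoint (connEvent ends s u ∩ clusterInEvent ends s {W : Set V | o ∈ W})
      (connEvent ends s u ∩ connEvent ends y o ∩ (connEvent ends s y)ᶜ) := by
  rw [Set.disjoint_left]
  rintro ω ⟨_, hh⟩ ⟨⟨_, hl⟩, hQ⟩
  exact hQ (conn_s_y_of_conn_y_o_conn_s_o_v5 hl hh)

omit [Fintype V] [DecidableEq V] [Fintype E] [DecidableEq E] in
/-- `h ∪ ℓ = h ∪ (ℓ ∩ Q)`. -/
lemma union_eq_v5 (ends : E → Sym2 V) (s y o : V) :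
    clusterInEvent ends s {W : Set V | o ∈ W} ∪ connEvent ends y o =
      clusterInEvent ends s {W : Set V | o ∈ W} ∪ (connEvent ends y o ∩ (connEvent ends s y)ᶜ) := by
  ext ω
  constructor
  · rintro (hh | hl)
    · exact Or.inl hh
    · by_cases hh : ω ∈ clusterInEvent ends s {W : Set V | o ∈ W}
      · exact Or.inl hh
      · exact Or.inr ⟨hl, fun hS => hh (conn_s_o_of_conn_s_y_conn_y_o_v5 hS hl)⟩
  · rintro (hh | ⟨hl, _⟩)
    · exact Or.inl hh
    · exact Or.inr hl

omit [Fintype V] [DecidableEq V] [Fintype E] [DecidableEq E] in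
/-- `h` and `ℓ ∩ Q` are disjoint. -/
lemma disjoint_union_v5 (ends : E → Sym2 V) (s y o : V) :
    Disjoint (clusterInEvent ends s {W : Set V | o ∈ W})
      (connEvent ends y o ∩ (connEvent ends s y)ᶜ) := by
  rw [Set.disjoint_left]
  rintro ω hh ⟨hl, hQ⟩
  exact hQ (conn_s_y_of_conn_y_o_conn_s_o_v5 hl hh)

omit [Fintype V] [DecidableEq V] [Fintype E] [DecidableEq E] in
/-- `a ∩ (h ∪ ℓ) ∩ Q = (a ∩ h ∩ Q) ∪ (a ∩ ℓ ∩ Q)`. -/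
lemma inter_union_inter_compl_eq_v5 (ends : E → Sym2 V) (s y o u : V) :
    connEvent ends s u ∩ (clusterInEvent ends s {W : Set V | o ∈ W} ∪ connEvent ends y o) ∩
        (connEvent ends s y)ᶜ =
      (connEvent ends s u ∩ clusterInEvent ends s {W : Set V | o ∈ W} ∩ (connEvent ends s y)ᶜ) ∪
        (connEvent ends s u ∩ connEvent ends y o ∩ (connEvent ends s y)ᶜ) := by
  ext ω
  constructor
  · rintro ⟨⟨ha, hm⟩, hQ⟩
    rcases hm with hh | hl
    · exact Or.inl ⟨⟨ha, hh⟩, hQ⟩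
    · exact Or.inr ⟨⟨ha, hl⟩, hQ⟩
  · rintro (⟨⟨ha, hh⟩, hQ⟩ | ⟨⟨ha, hl⟩, hQ⟩)
    · exact ⟨⟨ha, Or.inl hh⟩, hQ⟩
    · exact ⟨⟨ha, Or.inr hl⟩, hQ⟩

omit [Fintype V] [DecidableEq V] [Fintype E] [DecidableEq E] in
/-- `a ∩ h ∩ Q` and `a ∩ ℓ ∩ Q` are disjoint. -/
lemma disjoint_inter_compl_v5 (ends : E → Sym2 V) (s y o u : V) :
    Disjoint (connEvent ends s u ∩ clusterInEvent ends s {W : Set V | o ∈ W} ∩ (connEvent ends s y)ᶜ)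
      (connEvent ends s u ∩ connEvent ends y o ∩ (connEvent ends s y)ᶜ) := by
  rw [Set.disjoint_left]
  rintro ω ⟨⟨_, hh⟩, hQ⟩ ⟨⟨_, hl⟩, _⟩
  exact hQ (conn_s_y_of_conn_y_o_conn_s_o_v5 hl hh)

omit [Fintype V] [DecidableEq V] [Fintype E] [DecidableEq E] in
/-- `(h ∪ ℓ) ∩ S = h ∩ S`: on `s ↔ y` the events `o ∈ C_s` and `o ↔ y` coincide. -/
lemma union_inter_eq_v5 (ends : E → Sym2 V) (s y o : V) :
    (clusterInEvent ends s {W : Set V | o ∈ W} ∪ connEvent ends y o) ∩ connEvent ends s y =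
      clusterInEvent ends s {W : Set V | o ∈ W} ∩ connEvent ends s y := by
  ext ω
  constructor
  · rintro ⟨hm, hS⟩
    refine ⟨?_, hS⟩
    rcases hm with hh | hl
    · exact hh
    · exact conn_s_o_of_conn_s_y_conn_y_o_v5 hS hl
  · rintro ⟨hh, hS⟩
    exact ⟨Or.inl hh, hS⟩

omit [Fintype V] [DecidableEq V] [LinearOrder R] [IsStrictOrderedRing R] in
/-- **The exact decomposition of the (R2-1) slack**: with `Q = {s ↮ y}`, `S = {s ↔ y}`,
`m = h ∪ ℓ`, the slack `P(𝟙ah) + P(𝟙ℓa) + P(𝟙)P(ah) − P(𝟙a)P(h) − P(𝟙h)P(a) − P(𝟙ℓ)P(a)` equals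
`P(Q)·[P(am) − P(a)P(m)] + [P(Q)·P(Qah) − P(Qa)·P(Qh)] + [P(S)·P(Qam) + P(Sa)·P(Sm) − P(S)·P(a)·P(m)]`. -/
lemma r21_slack_eq_v5_decomposition (p : E → R) (ends : E → Sym2 V) (s y o u : V) :
    prob p (connEvent ends s u ∩ clusterInEvent ends s {W : Set V | o ∈ W} ∩ (connEvent ends s y)ᶜ) +
      prob p (connEvent ends s u ∩ connEvent ends y o ∩ (connEvent ends s y)ᶜ) +
      prob p (connEvent ends s y)ᶜ *
        prob p (connEvent ends s u ∩ clusterInEvent ends s {W : Set V | o ∈ W}) -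
      (prob p (connEvent ends s u ∩ (connEvent ends s y)ᶜ) *
          prob p (clusterInEvent ends s {W : Set V | o ∈ W}) +
        prob p (clusterInEvent ends s {W : Set V | o ∈ W} ∩ (connEvent ends s y)ᶜ) *
          prob p (connEvent ends s u) +
        prob p (connEvent ends y o ∩ (connEvent ends s y)ᶜ) * prob p (connEvent ends s u)) =
    prob p (connEvent ends s y)ᶜ *
        (prob p (connEvent ends s u ∩
            (clusterInEvent ends s {W : Set V | o ∈ W} ∪ connEvent ends y o)) -
          prob p (connEvent ends s u) *
            prob p (clusterInEvent ends s {W : Set V | o ∈ W} ∪ connEvent ends y o)) +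
      (prob p (connEvent ends s y)ᶜ *
          prob p (connEvent ends s u ∩ clusterInEvent ends s {W : Set V | o ∈ W} ∩
            (connEvent ends s y)ᶜ) -
        prob p (connEvent ends s u ∩ (connEvent ends s y)ᶜ) *
          prob p (clusterInEvent ends s {W : Set V | o ∈ W} ∩ (connEvent ends s y)ᶜ)) +
      (prob p (connEvent ends s y) *
          prob p (connEvent ends s u ∩
            (clusterInEvent ends s {W : Set V | o ∈ W} ∪ connEvent ends y o) ∩
            (connEvent ends s y)ᶜ) +
        prob p (connEvent ends s u ∩ connEvent ends s y) *
          prob p ((clusterInEvent ends s {W : Set V | o ∈ W} ∪ connEvent ends y o) ∩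
            connEvent ends s y) -
        prob p (connEvent ends s y) * prob p (connEvent ends s u) *
          prob p (clusterInEvent ends s {W : Set V | o ∈ W} ∪ connEvent ends y o)) := by
  have hM1 : prob p (connEvent ends s u ∩
      (clusterInEvent ends s {W : Set V | o ∈ W} ∪ connEvent ends y o)) =
      prob p (connEvent ends s u ∩ clusterInEvent ends s {W : Set V | o ∈ W}) +
        prob p (connEvent ends s u ∩ connEvent ends y o ∩ (connEvent ends s y)ᶜ) := by
    rw [inter_union_eq_v5, prob_union_of_disjoint p (disjoint_inter_v5 ends s y o u)]
  have hM2 : prob p (clusterInEvent ends s {W : Set V | o ∈ W} ∪ connEvent ends y o) =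
      prob p (clusterInEvent ends s {W : Set V | o ∈ W}) +
        prob p (connEvent ends y o ∩ (connEvent ends s y)ᶜ) := by
    rw [union_eq_v5, prob_union_of_disjoint p (disjoint_union_v5 ends s y o)]
  have hM3 : prob p (connEvent ends s u ∩
      (clusterInEvent ends s {W : Set V | o ∈ W} ∪ connEvent ends y o) ∩ (connEvent ends s y)ᶜ) =
      prob p (connEvent ends s u ∩ clusterInEvent ends s {W : Set V | o ∈ W} ∩
          (connEvent ends s y)ᶜ) +
        prob p (connEvent ends s u ∩ connEvent ends y o ∩ (connEvent ends s y)ᶜ) := by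
    rw [inter_union_inter_compl_eq_v5, prob_union_of_disjoint p (disjoint_inter_compl_v5 ends s y o u)]
  have hM4 : prob p ((clusterInEvent ends s {W : Set V | o ∈ W} ∪ connEvent ends y o) ∩
      connEvent ends s y) =
      prob p (clusterInEvent ends s {W : Set V | o ∈ W} ∩ connEvent ends s y) := by
    rw [union_inter_eq_v5]
  have hM5 := prob_inter_add_prob_inter_compl p (connEvent ends s u) (connEvent ends s y)
  have hM6 := prob_inter_add_prob_inter_compl p (clusterInEvent ends s {W : Set V | o ∈ W})
    (connEvent ends s y)
  have hM7 := prob_compl p (connEvent ends s y)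
  rw [hM1, hM2, hM3, hM4, hM7]
  rw [← hM5, ← hM6]
  ring

/-- **(R2-1) from (V5).**  If the conditional-covariance bound (V5) holds,
`P(S)·P(a)·P(m) ≤ P(S)·P(Q a m) + P(S a)·P(S m)` with `S = {s ↔ y}`, `Q = {s ↮ y}`, `a = {u ∈ C_s}`,
`m = {o ∈ C_s} ∪ {o ↔ y}` — equivalently `Cov(a, m) ≥ P(S)·Cov(a, m | S)` — then (R2-1) holds:
`P(𝟙a)·P(h) + P(𝟙h)·P(a) + P(𝟙ℓ)·P(a) ≤ P(𝟙ah) + P(𝟙ℓa) + P(𝟙)·P(ah)`.  Proof: the exact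
decomposition `r21_slack_eq_v5_decomposition`, Harris for the increasing events `a`, `m`, and
BHK06 Theorem 1.2 (`bhk_same_cluster_events`) for the cluster of `s` under the avoidance `s ↮ y`. -/
theorem r21_of_v5 (p : E → R) (hp : IsProbVec p) (ends : E → Sym2 V) (s y o u : V)
    (hV5 : prob p (connEvent ends s y) * prob p (connEvent ends s u) *
        prob p (clusterInEvent ends s {W : Set V | o ∈ W} ∪ connEvent ends y o) ≤
      prob p (connEvent ends s y) *
          prob p (connEvent ends s u ∩
            (clusterInEvent ends s {W : Set V | o ∈ W} ∪ connEvent ends y o) ∩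
            (connEvent ends s y)ᶜ) +
        prob p (connEvent ends s u ∩ connEvent ends s y) *
          prob p ((clusterInEvent ends s {W : Set V | o ∈ W} ∪ connEvent ends y o) ∩
            connEvent ends s y)) :
    prob p (connEvent ends s u ∩ (connEvent ends s y)ᶜ) *
        prob p (clusterInEvent ends s {W : Set V | o ∈ W}) +
      prob p (clusterInEvent ends s {W : Set V | o ∈ W} ∩ (connEvent ends s y)ᶜ) *
        prob p (connEvent ends s u) +
      prob p (connEvent ends y o ∩ (connEvent ends s y)ᶜ) * prob p (connEvent ends s u) ≤
      prob p (connEvent ends s u ∩ clusterInEvent ends s {W : Set V | o ∈ W} ∩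
        (connEvent ends s y)ᶜ) +
      prob p (connEvent ends s u ∩ connEvent ends y o ∩ (connEvent ends s y)ᶜ) +
      prob p (connEvent ends s y)ᶜ *
        prob p (connEvent ends s u ∩ clusterInEvent ends s {W : Set V | o ∈ W}) := by
  have hdec := r21_slack_eq_v5_decomposition p ends s y o u
  -- Harris for `a` and `m = h ∪ ℓ`
  have hO : IsUpperSet {W : Set V | o ∈ W} := fun _ _ h hW => h hW
  have hU : IsUpperSet {W : Set V | u ∈ W} := fun _ _ h hW => h hW
  have hHar : prob p (connEvent ends s u) *
      prob p (clusterInEvent ends s {W : Set V | o ∈ W} ∪ connEvent ends y o) ≤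
      prob p (connEvent ends s u ∩
        (clusterInEvent ends s {W : Set V | o ∈ W} ∪ connEvent ends y o)) :=
    prob_mul_prob_le_prob_inter hp (isUpperSet_connEvent ends s u)
      ((isUpperSet_clusterInEvent ends s hO).union (isUpperSet_connEvent ends y o))
  -- BHK06 Theorem 1.2 for the cluster of `s` under the avoidance `s ↮ y`
  have hB := bhk_same_cluster_events p hp ends s y hU hO
  rw [clusterInEvent_mem_eq_connEvent_ycl ends s u] at hB
  have hq : 0 ≤ prob p (connEvent ends s y)ᶜ := prob_nonneg hp _
  have h1 := mul_nonneg hq (sub_nonneg.2 hHar)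
  nlinarith [hdec, h1, hB, hV5]

end R21OfV5

end Summit.Ventures.PercRepro2
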